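import Summits.Ventures.PercRepro.C026Ball

/-!
# mine-3's Theorem Z: the least-radius ball map (p5, gen 15)

mine-3 (`proofs/MINE3-FLIPS.md` §7, INBOX 5235 / 5242). For a source `S` whose closed `c`-cluster `D = Com_c(S̄)`
is at open distance `r + 1` from the mark `a`, the **ball map** `Z(S) = S Δ (E_inc(D) ∖ E_inc(B_r(a)))` flips `D`
and seals it except for its edges at the open ball of radius `r` around `a` (these are exactly its edges to the
sphere of radius `r`: no vertex at distance `≤ r − 1` is adjacent to `D`). The `r'`-DECODING of a configuration
`τ` deletes the ball of radius `r'` of `τ`, takes the open cluster `D'` of `c` there, and flips `E_inc(D') ∖ E_inc(B)`;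
it is VALID for the source class `P` when it returns a source whose closed `c`-cluster is `D'` at distance
`r' + 1`. The DOMAIN of the ball map is the set of sources whose image has their own radius as its LEAST valid
decoding radius (`BallDom`). Theorem M's `sealFlip c a` is the radius-`0` case (`ball 0 = {a}`).

* `ballFlip c a r ω` (`Z_r`), `closeAtSet`, `decodeCluster`, `decode`, `ValidDecoding`, `BallDom`, `radius`;
* **the LEMMA** (§7): `ball_ballFlip_eq` (distances `≤ r` agree in `S` and `Z(S)`), `decodeCluster_ballFlip`
  (`D = Com_c(Z(S) − B_r(a))`), **`decode_ballFlip`** (the `r`-decoding of `Z(S)` returns `S`),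
  `validDecoding_ballFlip`, `cluster_ballFlip_eq` (`Com_c(Z(S)) = D ∪ A₁`, mine-3's class `W_a(S)` of memo
  §28), **`ballFlip_mem_cell`** (`Z(S) ∈ ac|b` whenever `b ∉ D` and every open `a`–`b` walk of `S` meets `D`);
* **THEOREM Z**: `ballFlip_injOn_ballDom` (`Z` is injective on its domain) and **`card_ballDom_le`**
  (`#Dom_Z(P) ≤ #ac|b` for every source class `P` whose members have `b ∉ D` and no open `a`–`b` walk avoiding
  `D`); **`card_ballDom_nTwo_le`** / **`card_ballDom_nTwo_le'`** — Theorem Z for `N²` (INBOX 5242):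
  `#Dom_{Z_a}(N²) ≤ #ac|b`, `#Dom_{Z_b}(N²) ≤ #bc|a`.
-/

namespace PercRepro

open Finset

namespace MultiGraph

section BallFlip

variable {V E : Type*} (G : MultiGraph V E)

open Classical in
/-- **mine-3's ball map** `Z_r(S) = S Δ (E_inc(D) ∖ E_inc(B_r(a)))`, `D = Com_c(S̄)`: the closed cluster of `c` is
flipped and sealed, except that its edges at the open ball of radius `r` around `a` keep their state. -/
noncomputable def ballFlip (c a : V) (r : ℕ) (ω : Config E) : Config E :=
  fun e => if e ∈ G.edgesAt (G.cluster ωᶜ c) ∧ e ∉ G.edgesAt (G.ball ω a r) then !ω e else ω e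

open Classical in
/-- Every edge at the vertex set `X` closed (the set `X` deleted). -/
noncomputable def closeAtSet (X : Set V) (ω : Config E) : Config E :=
  fun e => if e ∈ G.edgesAt X then false else ω e

/-- The cluster read off an image: `D' = Com_c(τ − B_r(a))`, the open cluster of `c` in `τ` with the ball of
radius `r` around `a` deleted. -/
noncomputable def decodeCluster (c a : V) (r : ℕ) (τ : Config E) : Set V :=
  G.cluster (G.closeAtSet (G.ball τ a r) τ) c

open Classical in
/-- The `r`-decoding of `τ`: flip the edges at `D' = Com_c(τ − B_r(a))` that are not at the ball `B_r(a)`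
of `τ`. -/
noncomputable def decode (c a : V) (r : ℕ) (τ : Config E) : Config E :=
  fun e => if e ∈ G.edgesAt (G.decodeCluster c a r τ) ∧ e ∉ G.edgesAt (G.ball τ a r) then !τ e else τ e

/-- The `r`-decoding of `τ` is VALID for the source class `P`: it returns a source of `P` whose closed
`c`-cluster is `D'` and lies at distance `r + 1` from `a`. -/
def ValidDecoding (P : Config E → Prop) (c a : V) (r : ℕ) (τ : Config E) : Prop :=
  P (G.decode c a r τ) ∧ G.cluster (G.decode c a r τ)ᶜ c = G.decodeCluster c a r τ ∧
    G.AtDist (G.decode c a r τ) a (G.decodeCluster c a r τ) r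

/-- **The domain of the ball map** for the source class `P`: the sources `S ∈ P` at distance `r + 1` from
their closed `c`-cluster whose image `Z_r(S)` has `r` as its LEAST valid decoding radius. -/
def BallDom (P : Config E → Prop) (c a : V) (ω : Config E) : Prop :=
  P ω ∧ ∃ r, G.AtDist ω a (G.cluster ωᶜ c) r ∧
    IsLeast {r' | G.ValidDecoding P c a r' (G.ballFlip c a r ω)} r

open Classical in
/-- The radius of a configuration: `dist_S(a, D) − 1` when `a` reaches `D = Com_c(S̄)`, else `0`. -/
noncomputable def radius (c a : V) (ω : Config E) : ℕ :=
  if h : ∃ r, G.AtDist ω a (G.cluster ωᶜ c) r then Classical.choose h else 0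

variable {G}

/-- The radius of a configuration at distance `r + 1` from `D` is `r`. -/
theorem radius_eq {c a : V} {ω : Config E} {r : ℕ} (h : G.AtDist ω a (G.cluster ωᶜ c) r) :
    G.radius c a ω = r := by
  unfold radius
  have hex : ∃ r, G.AtDist ω a (G.cluster ωᶜ c) r := ⟨r, h⟩
  rw [dif_pos hex]
  exact (Classical.choose_spec hex).unique h

/-! ### The ball map edge by edge -/

/-- The ball map flips an edge at `D` that is not at the ball. -/
theorem ballFlip_apply_of_mem {c a : V} {r : ℕ} {ω : Config E} {e : E}
    (he : e ∈ G.edgesAt (G.cluster ωᶜ c)) (hB : e ∉ G.edgesAt (G.ball ω a r)) :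
    G.ballFlip c a r ω e = !ω e := by
  simp [ballFlip, he, hB]

/-- The ball map keeps every edge at the ball. -/
theorem ballFlip_apply_of_mem_ball {c a : V} {r : ℕ} {ω : Config E} {e : E}
    (hB : e ∈ G.edgesAt (G.ball ω a r)) : G.ballFlip c a r ω e = ω e := by
  simp [ballFlip, hB]

/-- The ball map keeps every edge away from `D`. -/
theorem ballFlip_apply_of_notMem {c a : V} {r : ℕ} {ω : Config E} {e : E}
    (he : e ∉ G.edgesAt (G.cluster ωᶜ c)) : G.ballFlip c a r ω e = ω e := by
  simp [ballFlip, he]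

/-- `closeAtSet` on an edge at `X`. -/
theorem closeAtSet_apply_of_mem {X : Set V} {ω : Config E} {e : E} (he : e ∈ G.edgesAt X) :
    G.closeAtSet X ω e = false := by
  simp [closeAtSet, he]

/-- `closeAtSet` away from `X`. -/
theorem closeAtSet_apply_of_notMem {X : Set V} {ω : Config E} {e : E} (he : e ∉ G.edgesAt X) :
    G.closeAtSet X ω e = ω e := by
  simp [closeAtSet, he]

/-- (F1): an edge at `D` and at a vertex set `X` disjoint from `D` is a boundary edge of the closed cluster
`D`, hence closed in `S̄` (open in `S`). -/
theorem compl_eq_false_of_mem_edgesAt_of_mem_edgesAt {c : V} {ω : Config E} {X : Set V}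
    (hX : ∀ u ∈ X, ¬ G.Conn ωᶜ c u) {e : E} (he : e ∈ G.edgesAt (G.cluster ωᶜ c))
    (heX : e ∈ G.edgesAt X) : ωᶜ e = false := by
  by_contra h
  have h' : ωᶜ e = true := by simpa using h
  have hfst : G.fst e ∈ G.cluster ωᶜ c := by
    rcases he with he | he
    · exact he
    · exact G.fst_mem_cluster_of_open h' he
  have hsnd : G.snd e ∈ G.cluster ωᶜ c := by
    rcases he with he | he
    · exact G.snd_mem_cluster_of_open h' he
    · exact he
  rcases heX with heX | heX
  · exact hX _ heX hfst
  · exact hX _ heX hsnd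

/-! ### The LEMMA: distances below `r + 1` are untouched, the decoding returns the source -/

/-- No edge at a ball of radius `< r` is at `D` (an open one would put `D` at distance `≤ r`, a closed one
would put the ball vertex in `D`). -/
theorem not_mem_edgesAt_cluster_of_mem_edgesAt_ball {c a : V} {ω : Config E} {r : ℕ}
    (h : G.AtDist ω a (G.cluster ωᶜ c) r) {m : ℕ} (hm : m < r) {e : E}
    (he : e ∈ G.edgesAt (G.ball ω a m)) : e ∉ G.edgesAt (G.cluster ωᶜ c) := by
  intro heD
  have hm' : m ≤ r := Nat.le_of_lt hm
  -- the ball endpoint is outside `D`, so the edge is a boundary edge of `D`, open in `S`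
  have hopen : ω e = true := by
    have := compl_eq_false_of_mem_edgesAt_of_mem_edgesAt (X := G.ball ω a m)
      (fun u hu => h.not_mem_of_mem_ball hm' hu) heD he
    rw [compl_apply_not] at this
    simpa using this
  -- so the `D`-endpoint lies in the ball of radius `m + 1 ≤ r`: contradiction
  have hstep : ∀ {u v : V}, u ∈ G.ball ω a m → v ∈ G.cluster ωᶜ c →
      ((G.fst e = u ∧ G.snd e = v) ∨ (G.fst e = v ∧ G.snd e = u)) → False := by
    intro u v hu hv hend
    have hv' : v ∈ G.ball ω a (m + 1) := mem_ball_succ_of_openAdj hu ⟨e, hopen, hend⟩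
    exact h.not_mem_of_mem_ball (Nat.succ_le_of_lt hm) hv' hv
  rcases he with he | he <;> rcases heD with heD | heD
  · exact h.not_mem_of_mem_ball hm' he heD
  · exact hstep he heD (Or.inl ⟨rfl, rfl⟩)
  · exact hstep he heD (Or.inr ⟨rfl, rfl⟩)
  · exact h.not_mem_of_mem_ball hm' he heD

/-- **Distances `≤ r` agree in `S` and `Z_r(S)`**: the balls of radius `n ≤ r` coincide. -/
theorem ball_ballFlip_eq {c a : V} {ω : Config E} {r : ℕ} (h : G.AtDist ω a (G.cluster ωᶜ c) r)
    {n : ℕ} (hn : n ≤ r) : G.ball (G.ballFlip c a r ω) a n = G.ball ω a n := by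
  refine ball_eq_of_agree ?_
  intro m hm e he
  rw [ballFlip_apply_of_notMem
    (not_mem_edgesAt_cluster_of_mem_edgesAt_ball h (Nat.lt_of_lt_of_le hm hn) he)]

/-- **`D = Com_c(Z_r(S) − B_r(a))`**: the closed cluster of `c` is the cluster read off the image. -/
theorem decodeCluster_ballFlip {c a : V} {ω : Config E} {r : ℕ}
    (h : G.AtDist ω a (G.cluster ωᶜ c) r) :
    G.decodeCluster c a r (G.ballFlip c a r ω) = G.cluster ωᶜ c := by
  unfold decodeCluster
  rw [ball_ballFlip_eq h le_rfl]
  refine cluster_eq_of_agree ?_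
  intro e he
  by_cases hB : e ∈ G.edgesAt (G.ball ω a r)
  · rw [closeAtSet_apply_of_mem hB]
    exact compl_eq_false_of_mem_edgesAt_of_mem_edgesAt (fun u hu => h.1 u hu) he hB
  · rw [closeAtSet_apply_of_notMem hB, ballFlip_apply_of_mem he hB, compl_apply_not]

/-- **The `r`-decoding of `Z_r(S)` returns `S`.** -/
theorem decode_ballFlip {c a : V} {ω : Config E} {r : ℕ} (h : G.AtDist ω a (G.cluster ωᶜ c) r) :
    G.decode c a r (G.ballFlip c a r ω) = ω := by
  funext e
  unfold decode
  rw [decodeCluster_ballFlip h, ball_ballFlip_eq h le_rfl]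
  by_cases hflip : e ∈ G.edgesAt (G.cluster ωᶜ c) ∧ e ∉ G.edgesAt (G.ball ω a r)
  · rw [if_pos hflip, ballFlip_apply_of_mem hflip.1 hflip.2, Bool.not_not]
  · rw [if_neg hflip]
    by_cases hB : e ∈ G.edgesAt (G.ball ω a r)
    · exact ballFlip_apply_of_mem_ball hB
    · have heD : e ∉ G.edgesAt (G.cluster ωᶜ c) := fun heD => hflip ⟨heD, hB⟩
      exact ballFlip_apply_of_notMem heD

/-- **The `r`-decoding of `Z_r(S)` is valid** for every source class containing `S`. -/
theorem validDecoding_ballFlip {P : Config E → Prop} {c a : V} {ω : Config E} {r : ℕ}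
    (hP : P ω) (h : G.AtDist ω a (G.cluster ωᶜ c) r) :
    G.ValidDecoding P c a r (G.ballFlip c a r ω) := by
  refine ⟨?_, ?_, ?_⟩
  · rw [decode_ballFlip h]
    exact hP
  · rw [decode_ballFlip h, decodeCluster_ballFlip h]
  · rw [decode_ballFlip h, decodeCluster_ballFlip h]
    exact h

/-! ### The image lies in the cell `ac|b` -/

/-- `D` is open-connected in `Z_r(S)` (F2: its closed edges are flipped; its kept edges, at the ball, were
boundary edges, hence open). -/
theorem conn_ballFlip_of_conn_compl {c a : V} {ω : Config E} {r : ℕ}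
    (h : G.AtDist ω a (G.cluster ωᶜ c) r) {v : V} (hv : G.Conn ωᶜ c v) :
    G.Conn (G.ballFlip c a r ω) c v := by
  refine conn_of_open_edges ?_ hv
  intro e he hmem
  by_cases hB : e ∈ G.edgesAt (G.ball ω a r)
  · exact absurd he (by
      rw [compl_eq_false_of_mem_edgesAt_of_mem_edgesAt (fun u hu => h.1 u hu) hmem hB]
      exact Bool.false_ne_true)
  · rw [ballFlip_apply_of_mem hmem hB, ← compl_apply_not]
    exact he

/-- `a` lies in the open cluster of `c` in `Z_r(S)`: a vertex of `D` at distance `r + 1` is joined by a kept open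
edge to the ball of radius `r`, whose vertices keep their paths from `a`. -/
theorem conn_ballFlip_c_a {c a : V} {ω : Config E} {r : ℕ} (h : G.AtDist ω a (G.cluster ωᶜ c) r) :
    G.Conn (G.ballFlip c a r ω) c a := by
  obtain ⟨d, hd, hdD⟩ := h.2
  rcases hd with hd | ⟨u, hu, e, he, hend⟩
  · exact absurd hdD (h.1 d hd)
  · have hT : G.ballFlip c a r ω e = true := by
      rw [ballFlip_apply_of_mem_ball (mem_edgesAt_of_openAdj_left hu hend)]
      exact he
    have hau : G.Conn (G.ballFlip c a r ω) a u := by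
      refine conn_of_mem_ball (n := r) ?_
      rw [ball_ballFlip_eq h le_rfl]
      exact hu
    exact ((conn_ballFlip_of_conn_compl h hdD).trans (Conn.of_openAdj ⟨e, hT, hend⟩).symm).trans
      hau.symm

/-- Every vertex of the open cluster of `c` in `Z_r(S)` lies in `D` or is reached from `a` by an open walk of
`S` avoiding `D` (the open exits of `D` lead into the ball of radius `r`, whose vertices are reached from `a`
by walks avoiding `D`). -/
theorem conn_compl_or_connAvoid_of_conn_ballFlip {c a : V} {ω : Config E} {r : ℕ}
    (h : G.AtDist ω a (G.cluster ωᶜ c) r) {v : V} (hv : G.Conn (G.ballFlip c a r ω) c v) :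
    G.Conn ωᶜ c v ∨ G.ConnAvoid ω (G.cluster ωᶜ c) a v := by
  refine Conn.induction
    (motive := fun x => G.Conn ωᶜ c x ∨ G.ConnAvoid ω (G.cluster ωᶜ c) a x)
    (Or.inl (Conn.refl G ωᶜ c)) ?_ hv
  intro x y _ hxy ih
  obtain ⟨e, he, hend⟩ := hxy
  by_cases hyD : G.Conn ωᶜ c y
  · exact Or.inl hyD
  rcases ih with hxD | hxA
  · -- `x ∈ D`, `y ∉ D`: a boundary edge of `D`, open in the image only if it is at the ball; then `y` is in it
    have heD : e ∈ G.edgesAt (G.cluster ωᶜ c) := mem_edgesAt_of_openAdj_left hxD hend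
    by_cases hB : e ∈ G.edgesAt (G.ball ω a r)
    · have hyB : y ∈ G.ball ω a r := by
        rcases hend with ⟨h1, h2⟩ | ⟨h1, h2⟩ <;> rcases hB with hB | hB
        · exact absurd (by rw [h1]; exact hxD) (h.1 _ hB)
        · rw [← h2]; exact hB
        · rw [← h1]; exact hB
        · exact absurd (by rw [h2]; exact hxD) (h.1 _ hB)
      exact Or.inr (connAvoid_of_mem_ball (fun u hu => h.1 u hu) hyB)
    · rw [ballFlip_apply_of_mem heD hB, ← compl_apply_not] at he
      have hyD' : y ∈ G.cluster ωᶜ c := by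
        rcases hend with ⟨h1, h2⟩ | ⟨h1, h2⟩
        · rw [← h2]; exact G.snd_mem_cluster_of_open he (by rw [h1]; exact hxD)
        · rw [← h1]; exact G.fst_mem_cluster_of_open he (by rw [h2]; exact hxD)
      exact absurd hyD' hyD
  · -- `x ∉ D`, `y ∉ D`: the edge is away from `D`, so it is open in `S`
    have hxD : ¬ G.Conn ωᶜ c x := hxA.notMem_of_notMem (h.1 a (self_mem_ball ω a r))
    have heD : e ∉ G.edgesAt (G.cluster ωᶜ c) := notMem_edgesAt_of_notMem_of_notMem hend hxD hyD
    rw [ballFlip_apply_of_notMem heD] at he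
    exact Or.inr (hxA.tail ⟨⟨e, he, hend⟩, hxD, hyD⟩)

/-- An open walk of `S` avoiding `D` survives in `Z_r(S)` (no edge away from `D` is touched). -/
theorem conn_ballFlip_of_connAvoid {c a : V} {r : ℕ} {ω : Config E} {u v : V}
    (h : G.ConnAvoid ω (G.cluster ωᶜ c) u v) : G.Conn (G.ballFlip c a r ω) u v := by
  unfold ConnAvoid at h
  induction h with
  | refl => exact Conn.refl G _ u
  | tail _ hxy ih =>
    obtain ⟨⟨e, he, hend⟩, hx, hy⟩ := hxy
    refine ih.tail ⟨e, ?_, hend⟩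
    rw [ballFlip_apply_of_notMem (notMem_edgesAt_of_notMem_of_notMem hend hx hy)]
    exact he

/-- **The cluster of `c` in `Z_r(S)`** (mine-3's class `W_a(S) = D ∪ A₁`, memo §28): the closed cluster `D`
together with the vertices reached from `a` by open walks of `S` avoiding `D`. -/
theorem cluster_ballFlip_eq {c a : V} {ω : Config E} {r : ℕ} (h : G.AtDist ω a (G.cluster ωᶜ c) r) :
    G.cluster (G.ballFlip c a r ω) c =
      G.cluster ωᶜ c ∪ {v | G.ConnAvoid ω (G.cluster ωᶜ c) a v} := by
  ext v
  simp only [mem_cluster, Set.mem_union, Set.mem_setOf_eq]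
  constructor
  · exact conn_compl_or_connAvoid_of_conn_ballFlip h
  · rintro (hv | hv)
    · exact conn_ballFlip_of_conn_compl h hv
    · exact (conn_ballFlip_c_a h).trans (conn_ballFlip_of_connAvoid hv)

/-- **`Z_r(S) ∈ ac|b`** whenever `b ∉ D` and every open `a`–`b` walk of `S` meets `D`. -/
theorem ballFlip_mem_cell {c a b : V} {ω : Config E} {r : ℕ} (h : G.AtDist ω a (G.cluster ωᶜ c) r)
    (hb : ¬ G.Conn ωᶜ c b) (hav : ¬ G.ConnAvoid ω (G.cluster ωᶜ c) a b) :
    G.Conn (G.ballFlip c a r ω) c a ∧ ¬ G.Conn (G.ballFlip c a r ω) c b := by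
  refine ⟨conn_ballFlip_c_a h, fun hc => ?_⟩
  rcases conn_compl_or_connAvoid_of_conn_ballFlip h hc with h1 | h1
  · exact hb h1
  · exact hav h1

/-! ### THEOREM Z -/

/-- The ball map at the radius of the configuration. -/
noncomputable def ballMap (c a : V) (ω : Config E) : Config E := G.ballFlip c a (G.radius c a ω) ω

/-- **THEOREM Z (injectivity)**: the ball map is injective on its domain — two sources with one image have the
same radius (the least valid decoding radius of the image), and the decoding at that radius returns both. -/
theorem ballMap_injOn_ballDom (P : Config E → Prop) (c a : V) :
    Set.InjOn (G.ballMap c a) {ω | G.BallDom P c a ω} := by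
  intro ω hω ω' hω' hT
  obtain ⟨_, r, hr, hleast⟩ := hω
  obtain ⟨_, r', hr', hleast'⟩ := hω'
  have hZ : G.ballMap c a ω = G.ballFlip c a r ω := by
    unfold ballMap
    rw [radius_eq hr]
  have hZ' : G.ballMap c a ω' = G.ballFlip c a r' ω' := by
    unfold ballMap
    rw [radius_eq hr']
  rw [hZ, hZ'] at hT
  have hrr : r = r' := by
    rw [hT] at hleast
    exact hleast.unique hleast'
  subst hrr
  rw [← decode_ballFlip hr, ← decode_ballFlip hr', hT]

open Classical in
/-- **THEOREM Z (the count)**: for every source class `P` whose members have `b ∉ D` and no open `a`–`b` walk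
avoiding `D`, the domain of the ball map is at most as large as the cell `ac|b`. -/
theorem card_ballDom_le [Fintype E] (P : Config E → Prop) (c a b : V)
    (hP : ∀ ω, P ω → ¬ G.Conn ωᶜ c b ∧ ¬ G.ConnAvoid ω (G.cluster ωᶜ c) a b) :
    (univ.filter fun ω : Config E => G.BallDom P c a ω).card ≤
      (univ.filter fun ω : Config E => G.Conn ω c a ∧ ¬ G.Conn ω c b).card := by
  refine Finset.card_le_card_of_injOn (G.ballMap c a) ?_ ?_
  · intro ω hω
    simp only [Finset.coe_filter, Finset.mem_univ, true_and, Set.mem_setOf_eq] at hω ⊢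
    obtain ⟨hPω, r, hr, _⟩ := hω
    have hZ : G.ballMap c a ω = G.ballFlip c a r ω := by
      unfold ballMap
      rw [radius_eq hr]
    rw [hZ]
    exact ballFlip_mem_cell hr (hP ω hPω).1 (hP ω hPω).2
  · intro ω hω ω' hω' hT
    simp only [Finset.coe_filter, Finset.mem_univ, true_and, Set.mem_setOf_eq] at hω hω'
    exact ballMap_injOn_ballDom P c a hω hω' hT

open Classical in
/-- **THEOREM Z FOR `N²`, the `a`-side** (INBOX 5242): `#Dom_{Z_a}(N²) ≤ #ac|b`. -/
theorem card_ballDom_nTwo_le [Fintype E] (a b c : V) :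
    (univ.filter fun ω : Config E => G.BallDom (fun ω => G.NTwo ω a b c) c a ω).card ≤
      (univ.filter fun ω : Config E => G.Conn ω c a ∧ ¬ G.Conn ω c b).card :=
  card_ballDom_le _ c a b fun _ hω => ⟨hω.2.2.1, hω.2.2.2⟩

open Classical in
/-- **THEOREM Z FOR `N²`, the `b`-side**: `#Dom_{Z_b}(N²) ≤ #bc|a`. -/
theorem card_ballDom_nTwo_le' [Fintype E] (a b c : V) :
    (univ.filter fun ω : Config E => G.BallDom (fun ω => G.NTwo ω a b c) c b ω).card ≤
      (univ.filter fun ω : Config E => G.Conn ω c b ∧ ¬ G.Conn ω c a).card :=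
  card_ballDom_le _ c b a fun _ hω => ⟨hω.2.1, fun h => hω.2.2.2 h.symm⟩

end BallFlip

end MultiGraph

end PercRepro
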